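/-
Origin: expansion seat `planner-pub-hodgecm-mc-theta-3-g2-0`, handover #102 2026-08-18T21:41Z md5 5e2c59ee636f3b8413ecbce4a5f70e2b (RUN 33; NEW additive leaf, 268 l.; ns HodgeCM.Model.SupplyResidual (+ .WeilPairData); node J-W7a CLASS LEVEL: instModuleThetaTopOfAddCommGroup, WeilPairData.weilDatum_thetaLinear / kernelDatum_thetaLinear, WeilPairData.ClassSupplyData, ClassSupplyData.residualT/.residual/.supply, ClassSupplyPack, ClassSupplyPack.toPairSupplyData, open_su (`HOME/mc/pub-hodgecm-mc-theta-3-g2/aslanded/HodgeCM/Model/SupplyDischarge.lean`, md5 5e2c59ee, 268 lines);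
landed by the packager successor (mc-unitary-1-g3, gen-8 kit) in gate run 32 as `HodgeCM/Model/SupplyDischarge.lean` (verbatim).
-/
/-
Copyright (c) 2026. Released under Apache 2.0 license as described in the file LICENSE.
Cell pub-hodgecm, MODEL layer (construction prover mc-theta-3, gen 2), node J-W7a (class level) of `MODEL-DAG.md`.
-/
import Summits.HodgeConjecture.HodgeCM.Model.SupplyResidual
import Literature.NumberTheory.Automorphic.ThetaClassSupply

/-!
# The junction J-W7a at the class level: (W-resT) from the theta classes of the pair

`HodgeCM.Model.SupplyResidual` leaves ONE residual input of C4-supply per line `W_j`, in TREE vocabulary: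
`WeilPairData.ResidualT` — "`Θ̃_{φ_N}(χ⁻)(1) ≠ 0` for a character `χ` of the archimedean type forced by `w`
⇒ `∃ Γ, ∃ ω ∈ T.Theta V c k Γ, ω ≠ 0`".  This module discharges it ONE LEVEL FURTHER, to the vocabulary in
which the assembler defines `T.Theta` (node W6b-2, tree `Literature.NumberTheory.Automorphic.ThetaClassSupply`:
`WeightForms.ClassMapDatum`, `WeightForms.thetaClasses`, `ThetaKernelDatum.exists_thetaClass_mem_H10_ne_zero`),
over the theta FORMS of node W6b-1 (tree `Literature.NumberTheory.Weil1964.ThetaWeightForms`: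
`ThetaKernelDatum.thetaForm`, `thetaForms`, `IsThetaEquivariant`):

* KERNEL `WeilPairData.kernelDatum_thetaLinear` — Weil's theta datum of the pair (`repWeilThetaDatum`,
  `Θ_Φ(S) = Θ(ω(S)Φ)`) is `Θ`-LINEAR (`WeilThetaDatum.ThetaLinear`), because `ω(S)` and the theta
  distribution `thetaDistLM` are linear; this is the `hlin` every theta-form statement of the tree takes.
* `ClassSupplyData P T V c k` — the class-level inputs, as a DATA record over the pair data `P`:
  the `K`-type bookkeeping (`κ : Kc →* G_U(𝔸)`, the `K`-type `σ` on `E ∋ φ_∞`, the weight `τ` on `W`,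
  `ι : W^∨ → E`); the archimedean component (`ιinf : G₁ →* G_U(𝔸)`, `Δ`, `κ₁`, `τ₁`, `η₁` with the tree's
  `IsLevelCorrected` / `IsWeightMatched`); a level `Γ₀ : Level V` and a CLASS-MAP DATUM
  `D : ClassMapDatum ιinf hΔ hη (U.CohC (U.pms Lc ι₁ V Γ₀) 1)` INTO THE MODEL UNIVERSE (node D3-geom: the
  `(1,0)`-piece, the pullback to classical weight forms, the holomorphic subspace, DESCENT); the generating
  sets `𝓙` (theta-equivariant test families) and `𝓕` (weight functions); and four PROPERTIES, each an
  explicit field: `fam` — for every `N ≥ 1` the test function `φ_N` is the value `j(ι ℓ)` of a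
  theta-equivariant family `j ∈ 𝓙` (registry rows (W-K∞)/(W-Kf): `K_∞`- and level-equivariance of
  `φ_∞ ⊗ φ_{N,f}`); `char_mem` — the inverted characters `χ⁻` of the forced archimedean type lie in `𝓕`;
  `hol` — the restricted theta forms `(thetaForm j f)|_{G₁}` are holomorphic (registry row W6b-hol);
  `theta_sub` — the model's `T.Theta V c k Γ₀` CONTAINS the theta classes
  `thetaClasses ιinf D (thetaForms 𝓙 𝓕)` (the assembler's DEFINITION of `Θ_k`, read as an inclusion).
* KERNEL `ClassSupplyData.residualT : P.ResidualT T V c k` — by `exists_thetaClass_mem_H10_ne_zero` at the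
  archimedean point `x := 1` (`ιinf 1 = 1`): the non-vanishing scalar lift is a value of the theta form
  `thetaForm j χ⁻`, which is therefore `≠ 0`, holomorphic after restriction by `hol`, hence DESCENDS to a
  non-zero `(1,0)`-class, which lies in `thetaClasses` and so in `T.Theta V c k Γ₀` by `theta_sub`.
* `ClassSupplyPack T V c k` (carriers + pair data + class data), `ClassSupplyPack.toPairSupplyData`, and
  **`open_supply_of_classSupplyPack : (∀ V c, T.GoodCtx ι₁ c → Nonempty (ClassSupplyPack T V c 0) ∧
  Nonempty (ClassSupplyPack T V c 1)) → T.Open_supply`** — `Open_supply` BY NAME with NO residual left in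
  this lane: every remaining input is a named field of `WeilPairData` ((W-ω), (W-wt), (W-maj⁺), (W-rat⁺)) or
  of `ClassSupplyData` (D3-geom's class-map datum, (W-K∞)/(W-Kf), W6b-hol, the definition of `Θ_k`).

Nothing is cited and nothing is minted: every statement is proved from the fields of the data records.
-/

set_option autoImplicit false

noncomputable section

open MeasureTheory NumberField NumberField.mixedEmbedding IsDedekindDomain
open Literature.NumberTheory.Automorphic Literature.NumberTheory.Weil1964
open HodgeCM.PerL34.Seesaw HodgeCM.PerL34.RationalCoset HodgeCM.PerL34.SupplyAdelic
open HodgeCM.Model.SupplyInstance HodgeCM.Model.SupplyResidual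
open scoped Classical

namespace HodgeCM
namespace Model
namespace SupplyResidual

/-! ### § 0. The module structure of `ThetaTop` through `AddCommGroup` -/

/-- The tree's type synonym `WeilThetaDatum.ThetaTop D` (the carrier `SX` with its Θ-initial topology) inherits
the algebra of `SX` by the instances `instAddCommGroupThetaTop := ‹_›`, `instModuleThetaTop := ‹_›` of
`Weil1964/ThetaInitialTopology.lean`, the latter keyed on the `AddCommMonoid` instance of `SX`.  The tree's
theta-form statements bind `[AddCommGroup SX] [Module ℂ SX]`, i.e. they ask for the module structure over
`AddCommGroup.toAddCommMonoid`, which instance resolution cannot match against `instModuleThetaTop` without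
unfolding the synonym; this instance supplies exactly that reading (definitionally the module structure of
`SX`), so that `ThetaLinear`, `thetaForm`, `thetaForms`, … elaborate at `SX := D.ThetaTop`. -/
instance instModuleThetaTopOfAddCommGroup {Mp SX R : Type*} (D : WeilThetaDatum Mp SX) [Semiring R]
    [AddCommGroup SX] [h : Module R SX] :
    @Module R D.ThetaTop _ (AddCommGroup.toAddCommMonoid : AddCommMonoid D.ThetaTop) := h

namespace WeilPairData

variable {K L : Type} [Field K] [NumberField K] [Field L] [NumberField L] [Algebra K L] [FiniteDimensional K L]
variable {J : Type} [Fintype J] {GU : Type} [Group GU] [TopologicalSpace GU]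
variable (P : WeilPairData K L J GU)

/-! ### § 1. Θ-linearity of the pair datum (kernel) -/

/-- **Weil's theta datum of the pair is `Θ`-linear**: `Φ ↦ Θ_Φ(S) = Θ(ω(S)Φ)` is `ℂ`-linear for every `S`,
as the composite of the linear maps `ω(S)` and `thetaDistLM`. -/
theorem weilDatum_thetaLinear : P.weilDatum.ThetaLinear := fun S =>
  (thetaDistLM K J ∘ₗ (P.ω.toHomUnits S : Module.End ℂ (piSchwartzBruhat K J))).isLinear

variable [IsTopologicalGroup GU] [LocallyCompactSpace GU]

/-- The same for the Weil datum carried by the theta-kernel datum of the pair (on `ThetaTop`). -/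
theorem kernelDatum_thetaLinear : P.kernelDatum.W.ThetaLinear := fun S =>
  (thetaDistLM K J ∘ₗ (P.ω.toHomUnits S : Module.End ℂ (piSchwartzBruhat K J))).isLinear

/-! ### § 2. The class-level supply data over the pair data -/

/-- **Class-level supply data** for the type index `k` in the context `(V, c)` over the pair data `P`: the
`K`-type bookkeeping, the archimedean component, a level `Γ₀` with a class-map datum INTO the model universe,
the generating sets of theta forms, and the four properties `fam` / `char_mem` / `hol` / `theta_sub` (module
docstring).  Every property is an explicit field; nothing is asserted. -/
structure ClassSupplyData [CompactSpace (GU ⧸ P.ΓU)] {U : Universe} (T : U.ThetaModel) {Lc : CMField}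
    {ι₁ : Lc →+* ℂ} (V : HermSpace3 Lc ι₁) (c : SeesawCtx Lc) (k : Fin 4) : Type 1 where
  /-- index group of the `K`-types (`K_f × K_∞`) -/
  Kc : Type
  [instKc : Group Kc]
  /-- its map to `G_U(𝔸)` -/
  κ : Kc →* GU
  /-- the `K`-type containing `φ_∞` -/
  E : Type
  [instE : AddCommGroup E]
  [instEm : Module ℂ E]
  /-- the action of `Kc` on it -/
  σ : Representation ℂ Kc E
  /-- the weight module -/
  W : Type
  [instW : AddCommGroup W]
  [instWm : Module ℂ W]
  [instWr : Module.IsReflexive ℂ W]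
  /-- the weight -/
  τ : Representation ℂ Kc W
  /-- the `Kc`-map `W^∨ → E` -/
  ι : Module.Dual ℂ W →ₗ[ℂ] E
  /-- … intertwining `τ^∨` and `σ` -/
  hι : ∀ (x : Kc) (ℓ : Module.Dual ℂ W), ι (τ.dual x ℓ) = σ x (ι ℓ)
  /-- the archimedean component group `G₁ = G_U(ℝ)` -/
  G₁ : Type
  [instG₁ : Group G₁]
  /-- its maximal compact `K₁` -/
  K₁ : Type
  [instK₁ : Group K₁]
  /-- the inclusion of the archimedean component -/
  ιinf : G₁ →* GU
  /-- the arithmetic subgroup -/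
  Δ : Subgroup G₁
  /-- `K₁ → G₁` -/
  κ₁ : K₁ →* G₁
  /-- the classical weight -/
  τ₁ : Representation ℂ K₁ W
  /-- `K₁ → Kc` over `ιinf` -/
  η₁ : K₁ →* Kc
  /-- level correction (tree `WeightForms.IsLevelCorrected`) -/
  hΔ : WeightForms.IsLevelCorrected P.ΓU κ τ ιinf Δ
  /-- weight matching (tree `WeightForms.IsWeightMatched`) -/
  hη : WeightForms.IsWeightMatched κ τ ιinf κ₁ τ₁ η₁
  /-- the level at which the classes are produced -/
  Γ₀ : Level V
  /-- the class-map datum of `Γ₀ \ 𝔹²` into the model universe (node D3-geom) -/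
  D : WeightForms.ClassMapDatum ιinf hΔ hη (U.CohC (U.pms Lc ι₁ V Γ₀) 1)
  /-- the theta-equivariant test families generating the theta forms -/
  𝓙 : Set {j : E →ₗ[ℂ] P.weilDatum.ThetaTop // P.kernelDatum.IsThetaEquivariant κ σ j}
  /-- the weight functions generating the theta forms -/
  𝓕 : Set C(relNormOneIdeles K L ⧸ relNormOneRat K L, ℂ)
  /-- (W-K∞)/(W-Kf): every `φ_N`, `N ≥ 1`, is the value at `ι ℓ` of a family in `𝓙` -/
  fam : ∀ N : ℕ, 0 < N → ∃ j ∈ 𝓙, ∃ ℓ : Module.Dual ℂ W, j.1 (ι ℓ) = P.testFunT N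
  /-- the inverted characters of the forced archimedean type are weight functions -/
  char_mem : ∀ χ : PontryaginDual (relNormOneIdeles K L ⧸ relNormOneRat K L),
    (∀ t : relNormOneInfUnits K L,
      ((χ ((relNormOneInfToIdeles K L t : relNormOneIdeles K L) :
        relNormOneIdeles K L ⧸ relNormOneRat K L) : Circle) : ℂ) * P.w t = 1) → charInv χ ∈ 𝓕
  /-- W6b-hol: the restricted theta forms are holomorphic -/
  hol : ∀ j ∈ 𝓙, ∀ f ∈ 𝓕, WeightForms.restrictHom ιinf hΔ hη
    (P.kernelDatum.thetaForm (probHaarRelNormOneQuot K L) P.kernelDatum_thetaLinear κ j.1 j.2 ι hι f) ∈ D.Hol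
  /-- the model's `Θ_k` at level `Γ₀` contains the theta classes (the assembler's definition of `Θ_k`) -/
  theta_sub : WeightForms.thetaClasses ιinf D
    (P.kernelDatum.thetaForms (probHaarRelNormOneQuot K L) P.kernelDatum_thetaLinear κ σ ι hι 𝓙 𝓕) ⊆
      T.Theta V c k Γ₀

attribute [instance] ClassSupplyData.instKc ClassSupplyData.instE ClassSupplyData.instEm ClassSupplyData.instW
  ClassSupplyData.instWm ClassSupplyData.instWr ClassSupplyData.instG₁ ClassSupplyData.instK₁

/-! ### § 3. (W-resT) from class-level supply data (kernel) -/

variable [CompactSpace (GU ⧸ P.ΓU)] {U : Universe} {T : U.ThetaModel} {Lc : CMField} {ι₁ : Lc →+* ℂ}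
  {V : HermSpace3 Lc ι₁} {c : SeesawCtx Lc} {k : Fin 4}

/-- **(W-resT) discharged**: class-level supply data give the residual of `HodgeCM.Model.SupplyResidual`. -/
theorem ClassSupplyData.residualT (S : P.ClassSupplyData T V c k) : P.ResidualT T V c k := by
  intro N χ hN hχ hne
  obtain ⟨j, hj, ℓ, hjℓ⟩ := S.fam N hN
  have hf : charInv χ ∈ S.𝓕 := S.char_mem χ hχ
  have h1 : P.kernelDatum.thetaLiftFun (probHaarRelNormOneQuot K L) (j.1 (S.ι ℓ)) (charInv χ) (S.ιinf 1) ≠ 0 := by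
    rw [hjℓ, map_one]
    exact hne
  obtain ⟨cl, hcl, hcl0⟩ := P.kernelDatum.exists_thetaClass_mem_H10_ne_zero (probHaarRelNormOneQuot K L)
    P.kernelDatum_thetaLinear S.κ S.σ S.ι S.hι S.ιinf S.D hj hf h1 (S.hol j hj _ hf)
  exact ⟨S.Γ₀, (cl : U.CohC (U.pms Lc ι₁ V S.Γ₀) 1), S.theta_sub hcl, mt (Submodule.coe_eq_zero).mp hcl0⟩

/-- (W-res) from class-level supply data. -/
theorem ClassSupplyData.residual (S : P.ClassSupplyData T V c k) : P.toLineData.Residual T V c k :=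
  P.residual_of_residualT S.residualT

/-- **Supply of type index `k`** from pair data and class-level supply data: KERNEL. -/
theorem ClassSupplyData.supply (S : P.ClassSupplyData T V c k) : ∃ Γ : Level V, ∃ ω ∈ T.Theta V c k Γ, ω ≠ 0 :=
  P.supply S.residualT

end WeilPairData

/-! ### § 4. `Open_supply` from carriers + pair data + class data in every good context -/

/-- Carriers, pair Weil data and class-level supply data for the type index `k` in the context `(V, c)`. -/
structure ClassSupplyPack {U : Universe} (T : U.ThetaModel) {Lc : CMField} {ι₁ : Lc →+* ℂ}
    (V : HermSpace3 Lc ι₁) (c : SeesawCtx Lc) (k : Fin 4) : Type 1 where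
  /-- the base field `K = L₀` -/
  K : Type
  /-- the CM extension `L / K` -/
  L : Type
  instK : Field K
  instKnf : NumberField K
  instL : Field L
  instLnf : NumberField L
  instAlg : Algebra K L
  instFD : FiniteDimensional K L
  /-- the Lagrangian index type -/
  J : Type
  instJ : Fintype J
  /-- the adelic group `G_U(𝔸)` -/
  GU : Type
  instGU : Group GU
  instGUtop : TopologicalSpace GU
  instGUtg : IsTopologicalGroup GU
  instGUlc : LocallyCompactSpace GU
  /-- the pair Weil data -/
  P : WeilPairData K L J GU
  /-- `[G_U]` is compact (anisotropic `V`) -/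
  instCompact : CompactSpace (GU ⧸ P.ΓU)
  /-- the class-level supply data -/
  cls : P.ClassSupplyData T V c k

attribute [instance] ClassSupplyPack.instK ClassSupplyPack.instKnf ClassSupplyPack.instL ClassSupplyPack.instLnf
  ClassSupplyPack.instAlg ClassSupplyPack.instFD ClassSupplyPack.instJ ClassSupplyPack.instGU ClassSupplyPack.instGUtop
  ClassSupplyPack.instGUtg ClassSupplyPack.instGUlc ClassSupplyPack.instCompact

/-- A class supply pack gives pair supply data: the residual is PROVED (`ClassSupplyData.residualT`). -/
def ClassSupplyPack.toPairSupplyData {U : Universe} {T : U.ThetaModel} {Lc : CMField} {ι₁ : Lc →+* ℂ}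
    {V : HermSpace3 Lc ι₁} {c : SeesawCtx Lc} {k : Fin 4} (S : ClassSupplyPack T V c k) :
    PairSupplyData T V c k where
  K := S.K
  L := S.L
  instK := S.instK
  instKnf := S.instKnf
  instL := S.instL
  instLnf := S.instLnf
  instAlg := S.instAlg
  instFD := S.instFD
  J := S.J
  instJ := S.instJ
  GU := S.GU
  instGU := S.instGU
  instGUtop := S.instGUtop
  instGUtg := S.instGUtg
  instGUlc := S.instGUlc
  P := S.P
  instCompact := S.instCompact
  res := S.cls.residualT

/-- **`Open_supply` BY NAME from class supply packs** for the type indices `0, 1` in every good context — no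
residual hypothesis left in the supply lane. -/
theorem open_supply_of_classSupplyPack {U : Universe} (T : U.ThetaModel)
    (h : ∀ {Lc : CMField} {ι₁ : Lc →+* ℂ} (V : HermSpace3 Lc ι₁) (c : SeesawCtx Lc), T.GoodCtx ι₁ c →
      Nonempty (ClassSupplyPack T V c 0) ∧ Nonempty (ClassSupplyPack T V c 1)) :
    T.Open_supply :=
  open_supply_of_pairSupplyData T fun V c hc =>
    ⟨(h V c hc).1.map ClassSupplyPack.toPairSupplyData, (h V c hc).2.map ClassSupplyPack.toPairSupplyData⟩

end SupplyResidual
end Model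
end HodgeCM

end
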